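/-
Copyright: lit-balaban cell (HOME `run/shared/lean/pub/lit-balaban/`), Phase-2 proof seat p12 (gen 13).  Statement-level record of
a published text; nothing is claimed beyond what the kernel checks below.
-/
import Literature.MathematicalPhysics.QuantumFieldTheory.WilsonWeakCouplingBounds
import Literature.MathematicalPhysics.QuantumFieldTheory.GaussianToolkit
import HarnessLib

/-!
# `FariaDaVeigaOCarroll2022.FdVOC22StabilityBounds` (namespace `…QuantumFieldTheory.FariaDaVeigaOCarroll2022`) — P. A. Faria da Veiga, M. O'Carroll, *On Yang–Mills stability bounds
# and plaquette field generating function*, arXiv:2205.07376 (Rep. Math. Phys. **95** (2025) 303–380)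
# [FariaDaVeigaOCarroll2022YMStability]: **LEMMA 1** (the global quadratic upper bound on the plaquette action) and
# **THEOREM 1, free boundary conditions** — the factorized "thermodynamic and ultraviolet stable" bounds
# `z_ℓ^{Λ_r} ≤ Z_{Λ,a} ≤ z_u^{Λ_r}` on the Wilson `U(N)` partition function of a cube, uniformly in the volume AND in the
# coupling — PROVED on the tree's own lattice-gauge carriers

statement-level skeleton of published theorems with citation tags; proofs where landed; nothing here is a claim about
the Yang–Mills mass gap

Source held: `paper:arxiv-2205.07376` (corpus-tex layer, 25 chunks; page = chunk `pNNNN`, `L` = line).  Unit `lit-balaban-p12`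
(gen 13), free-target protocol G.5-34(d): the paper is CONTEXT ROW X2 of the cell's YM LIT SWEEP table `YM-INPRINT.md`
(readers p11/p12), graded there «NO (YM₄) — DIFFERENT STATEMENT PROVED»; this file formalizes that different statement.

WHAT IS PRINTED.  §2 (p0006): the free-b.c. cube `Λ` with `L` sites per side in `d = 2,3,4` dimensions, a gauge variable
`U ∈ U(N)` on each positively oriented bond with Haar measure `dσ`, the plaquette variable
«`U_p = e^{iagA_μ(x)} e^{iagA_ν(x+ae_μ)} e^{−iagA_μ(x+ae_ν)} e^{−iagA_ν(x)}`», the action «`A_p = ‖U_p−1‖²_{H-S} = 2 Re Tr(1−U_p)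
= 2 Tr(1 – cos X_p)`» (Ap), «`Z^B_{Λ,a} = ∫ exp[−(a^{d−4}/g²) A^B] dg^B`», `A^B = Σ_p A_p` (part); p0007: the «enhanced temporal
gauge» = a maximal tree of gauged-away bonds, `Λ_r` = the number of retained bonds, «`Λ_r = [(L−1)²], [(2L+1)(L−1)²],
[(3L³−L²−L−1)(L−1)]`, respectively, for `d = 2,3,4`».  §4 (p0014): **Lemma 1** (lower1) «`𝒜_p = ‖U_p−1‖²_{H-S} ≤ C² Σ_{1≤j≤4}
|x^j|² = C² Σ_j |λ_j|²`, `C = 2√N`», `U_p = e^{iX₁}e^{iX₂}e^{iX₃}e^{iX₄}`, `|x^j| = ‖X_j‖_{H-S}`, and (lower2) «`A^B ≤ 2(d−1) C² Σ_b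
|x^b|²`» summed over retained bonds; **Theorem 1** (sbfree) «Free b.c.: `z_ℓ^{Λ_r} ≤ Z_{Λ,a} ≤ z_u^{Λ_r}`», (zu) «`z_u = ∫ exp[−2
(a^{d−4}/g²) Re Tr(1−U)] dσ(U)`», (zl) «`z_ℓ = ∫ exp[−2C²(a^{d−4}/g²)(d−1) Tr X²] dσ(U)`».  §6 (p0018): proof of Lemma 1 (FTC on
`δ ↦ U_p(δ)`, triangle inequality, «`‖U_p − 1‖ ≥ N^{−1/2}‖U_p−1‖_{H-S}`»); proof of Theorem 1 (§6.2): «Upper Bound … An upper bound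
is obtained by discarding all horizontal plaquettes from the action, except those with temporal coordinates `x⁰=1`. We now
perform the horizontal bond integration … For each horizontal bond variable, integration appears in only one plaquette. …
using the left or right invariance of the Haar measure, the integral is independent of the other variables. In this way, we
extract a factor `z_u`. In the total procedure, we integrate over the `Λ_r` horizontal bonds, so that we extract a factor
`z_u^{Λ_r}`.  Lower Bound: Using Lemma 1 gives the factorization and `z_ℓ`.» and (p0018 L5) «The proof of the upper stability
bound on the partition function actually does not depend on this choice [of gauge]».

HOW IT IS TYPED (no new vocabulary; everything is the tree's).  The cube is Chatterjee's `B_n = halfOpenBox d n ⊂ ℤ^d`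
(`n = L`), configurations `ZdGaugeConfig d (𝔾 N)` (`𝔾 N = Matrix.unitaryGroup (Fin N) ℂ`), plaquette holonomy
`ZdGaugeConfig.plaquette` (the printed `U_p`, same orientation), the coupling `β := 2a^{d−4}/g²` so that the printed weight
`exp[−(a^{d−4}/g²)‖U_p − 1‖²_{H-S}] = exp[−β (N − Re tr U_p)]` is `Sweep1`'s Wilson weight and `Z_{Λ,a}` IS
`WilsonWeakCoupling.Z d N n β = zdPartitionFunction ι β (halfOpenBox d n)` (integral over ALL bond variables, no gauge fixed —
as in the print's definition (part)); the enhanced temporal gauge tree is Chatterjee's comb `AxialGauge.IsComb` (edges `(x,i)`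
with `x_k = 0` for `k > i`; the print's tree up to relabelling the axes), so `Λ_r = #(AxialGauge.freeEdges d n) = (d−1)n^d −
d n^{d−1} + 1` (`AxialGauge.card_freeEdges`; `= (3n³−n²−n−1)(n−1)` at `d = 4`, `(2n+1)(n−1)²` at `d = 3`, `(n−1)²` at `d = 2` —
the printed counts, `card_freeEdges_d4/d3/d2` below).  `z_u` is (zu) verbatim (`zu`).  For the lower bound we carry Lemma 1
in the Frobenius currency the tree uses everywhere: **`‖1 − U_p‖² ≤ 4 Σ_{j=1}^{4} ‖1 − U_j‖²`** (`norm_one_sub_plaquette_sq_le`;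
this is (lower1) with `C² = 4N` replaced by the SHARPER constant `4` and `|x^j|² = Σ_k λ_{j,k}²` replaced by `‖1 − U_j‖²_{H-S} =
Σ_k 2(1 − cos λ_{j,k}) ≤ |x^j|²`), whence `z_ℓ` here is `zl d N β = ∫ exp[−4(d−1)β ‖1 − U‖²] dσ(U)` (`= ∫ exp[−8(d−1)(a^{d−4}/g²)
‖1−U‖²_{H-S}]`), which is `≥` the printed (zl) `∫ exp[−8N(d−1)(a^{d−4}/g²) Σ_k λ_k²] dσ` pointwise in the integrand
(`‖1−U‖²_{H-S} ≤ Σλ_k² ≤ NΣλ_k²`): the lower bound proved here implies the printed one.  `β ≥ 0` throughout (the print has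
`a^{d−4}/g² > 0`).

WHAT IS PROVED (0 sorry, no new `def … : Prop`).
* §1 `norm_one_sub_plaquette_le`, `norm_one_sub_plaquette_sq_le` — Lemma 1 (lower1) in the Frobenius currency (from the tree's
  Lemma-7.4/7.5 facts `UnitaryCayley.norm_one_sub_mul_le`, `norm_one_sub_inv`); `S_le_sum_edges` — (lower2): in the comb gauge
  `S_{B_n}(U) ≤ 4(d−1) Σ_{e ∈ E_n^1} ‖1 − U_e‖²` via the incidence count `sum_plaquette_slots_le` (every bond lies in at most
  `2(d−1)` plaquettes of the cube: `d−1−k` + `k` + `d−1−k` + `k` over the four slots).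
* §2 `zu`, `zl` and their elementary properties (`zu_le_one`, `zl_le_one`, `zu_eq_lintegral_norm`).
* §3 the geometry of §6.2's «successive bond integrations» made explicit for every `d`: for a free edge `e = (y,k)` let
  `m = topDir e` be the LARGEST direction `m > k` with `y_m ≠ 0` and `partner e := (y − e_m, k, m)` — the plaquette "below" `e`
  in direction `m`, in which `e` is the third (inverted) letter; `partner_mem_plaquettesIn`, `partner_injective`, and the
  elimination-order lemma `eq_of_mem_edges_partner`: if a free edge `e₀ ≠ e` lies on `partner e` then `e = e₀ + e_m` (same
  direction, one step up), so `|e|₁ = |e₀|₁ + 1` — hence the free edge of maximal `ℓ¹` height in any family is private to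
  its own partner plaquette.
* §4 the Haar extraction `lintegral_pw_update_partner` («using the left or right invariance of the Haar measure, the integral
  is independent of the other variables … we extract a factor `z_u`»; also inversion invariance, the letter being inverted),
  the exact product formula `lintegral_prod_partner_eq : ∫ ∏_{e ∈ T} w(U_{partner e}) dσ^{E_n} = z_u^{#T}` for every family `T`
  of free edges (induction on the edge of maximal height, Mathlib `lmarginal`), and **`Z_le_zu_pow : Z(B_n, β) ≤ z_u^{Λ_r}`**
  (discard the non-partner plaquettes, weights `≤ 1`).
* §5 **`zl_pow_le_Z : z_ℓ^{Λ_r} ≤ Z(B_n, β)`**: comb-gauge fixing (the tree's `AxialGauge.lintegral_pi_eq_lintegral_free`,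
  Chatterjee Cor. 9.4 — the print's «gauging away … the value of the partition function is unchanged … (see [GJ])» p0007),
  Lemma 1, and Tonelli for the product Haar measure.
* §6 **`theorem1_free`** = (sbfree) both sides, every `d n N`, every `β ≥ 0`; the printed retained-bond counts.

NOT HERE (recorded, not claimed): periodic b.c. (sbperiodic); Theorem 2 (the `(a^{d−4}/g²)^{−N²/2}` extraction by the Weyl
integration formula) and hence Theorem 3's bounded normalized free energy; Theorem 4 (generating function).  Relation to the
tree's Chatterjee files (`WilsonWeakCouplingBounds`, `ChatterjeeFreeEnergyBounds`): those prove finer two-sided bounds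
(Lemmas 17.2/17.6) under `β ≥ 2` and a smallness relation `ρ₀(n, β) ≤ 1/8` between volume and coupling; Theorem 1 here is the
coarse product bound valid for ALL `n` and ALL `β ≥ 0`, which is the paper's point («not restricted to small g²», p0003).
-/

noncomputable section

open scoped Matrix.Norms.Frobenius ENNReal
open MeasureTheory Measure Finset Function
open Literature.Probability.LatticeModels Literature.MathematicalPhysics.QuantumLattice

namespace Literature.MathematicalPhysics.QuantumFieldTheory

namespace FariaDaVeigaOCarroll2022

open UnitaryCayley AxialGauge WilsonWeakCoupling

variable {d N : ℕ}

/-- Matrices `M_N(ℂ)` with the Frobenius (= Hilbert–Schmidt) norm. -/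
local notation "𝕄" => Matrix (Fin N) (Fin N) ℂ

/-- Sites of `ℤ^d`. -/
local notation "ZSite" => Literature.Probability.LatticeModels.Site

/-! ## §1. Lemma 1: the quadratic upper bound on the plaquette action (Frobenius currency) -/

/-- **Lemma 1, linear form**: `‖1 − U_p‖ ≤ Σ_{j=1}^4 ‖1 − U_j‖` for the plaquette holonomy `U_p = U₁U₂U₃⁻¹U₄⁻¹` (the print's
«`‖U_p − 1‖ ≤ Σ_j ‖𝓛_j‖`», p0018, with `‖1 − U_j‖` in place of `‖𝓛_j‖ = |x^j|`; unitary invariance of the Frobenius norm and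
`‖1 − U⁻¹‖ = ‖1 − U‖`). [cite: FariaDaVeigaOCarroll2022YMStability, Lemma 1 / §6.1 (chunks p0014, p0018)] -/
theorem norm_one_sub_plaquette_le (U : ZdGaugeConfig d (𝔾 N)) (x : ZSite d) (i j : Fin d) :
    ‖(1 : 𝕄) - ((U.plaquette x i j : 𝔾 N) : 𝕄)‖ ≤
      ‖(1 : 𝕄) - (U (x, i) : 𝕄)‖ + ‖(1 : 𝕄) - (U (x + Pi.single i 1, j) : 𝕄)‖ +
        ‖(1 : 𝕄) - (U (x + Pi.single j 1, i) : 𝕄)‖ + ‖(1 : 𝕄) - (U (x, j) : 𝕄)‖ := by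
  set a : 𝔾 N := U (x, i)
  set b : 𝔾 N := U (x + Pi.single i 1, j)
  set c : 𝔾 N := U (x + Pi.single j 1, i)
  set e : 𝔾 N := U (x, j)
  have hab : ‖(1 : 𝕄) - ((a * b : 𝔾 N) : 𝕄)‖ ≤ ‖(1 : 𝕄) - (a : 𝕄)‖ + ‖(1 : 𝕄) - (b : 𝕄)‖ := by
    rw [Submonoid.coe_mul]; exact norm_one_sub_mul_le a b
  have habc : ‖(1 : 𝕄) - ((a * b * c⁻¹ : 𝔾 N) : 𝕄)‖ ≤
      ‖(1 : 𝕄) - (a : 𝕄)‖ + ‖(1 : 𝕄) - (b : 𝕄)‖ + ‖(1 : 𝕄) - (c : 𝕄)‖ := by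
    rw [Submonoid.coe_mul]
    calc ‖(1 : 𝕄) - ((a * b : 𝔾 N) : 𝕄) * ((c⁻¹ : 𝔾 N) : 𝕄)‖
        ≤ ‖(1 : 𝕄) - ((a * b : 𝔾 N) : 𝕄)‖ + ‖(1 : 𝕄) - ((c⁻¹ : 𝔾 N) : 𝕄)‖ := norm_one_sub_mul_le _ _
      _ ≤ _ := by rw [norm_one_sub_inv]; linarith
  show ‖(1 : 𝕄) - ((a * b * c⁻¹ * e⁻¹ : 𝔾 N) : 𝕄)‖ ≤
      ‖(1 : 𝕄) - (a : 𝕄)‖ + ‖(1 : 𝕄) - (b : 𝕄)‖ + ‖(1 : 𝕄) - (c : 𝕄)‖ + ‖(1 : 𝕄) - (e : 𝕄)‖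
  rw [Submonoid.coe_mul]
  calc ‖(1 : 𝕄) - ((a * b * c⁻¹ : 𝔾 N) : 𝕄) * ((e⁻¹ : 𝔾 N) : 𝕄)‖
      ≤ ‖(1 : 𝕄) - ((a * b * c⁻¹ : 𝔾 N) : 𝕄)‖ + ‖(1 : 𝕄) - ((e⁻¹ : 𝔾 N) : 𝕄)‖ := norm_one_sub_mul_le _ _
    _ ≤ _ := by rw [norm_one_sub_inv]; linarith

/-- **Lemma 1** (lower1) in the Frobenius currency, four retained bonds: `‖1 − U_p‖² ≤ 4 Σ_{j=1}^4 ‖1 − U_j‖²` (the printed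
`𝒜_p = ‖U_p − 1‖²_{H-S} ≤ C² Σ_j |x^j|²`, `C² = 4N`, holds a fortiori: `4 ≤ 4N` and `‖1 − U_j‖² ≤ |x^j|²`).
[cite: FariaDaVeigaOCarroll2022YMStability, Lemma 1 (lower1) (chunk p0014)] -/
theorem norm_one_sub_plaquette_sq_le (U : ZdGaugeConfig d (𝔾 N)) (x : ZSite d) (i j : Fin d) :
    ‖(1 : 𝕄) - ((U.plaquette x i j : 𝔾 N) : 𝕄)‖ ^ 2 ≤
      4 * (‖(1 : 𝕄) - (U (x, i) : 𝕄)‖ ^ 2 + ‖(1 : 𝕄) - (U (x + Pi.single i 1, j) : 𝕄)‖ ^ 2 +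
        ‖(1 : 𝕄) - (U (x + Pi.single j 1, i) : 𝕄)‖ ^ 2 + ‖(1 : 𝕄) - (U (x, j) : 𝕄)‖ ^ 2) := by
  have h := norm_one_sub_plaquette_le U x i j
  have h0 : 0 ≤ ‖(1 : 𝕄) - ((U.plaquette x i j : 𝔾 N) : 𝕄)‖ := norm_nonneg _
  calc ‖(1 : 𝕄) - ((U.plaquette x i j : 𝔾 N) : 𝕄)‖ ^ 2
      ≤ (‖(1 : 𝕄) - (U (x, i) : 𝕄)‖ + ‖(1 : 𝕄) - (U (x + Pi.single i 1, j) : 𝕄)‖ +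
          ‖(1 : 𝕄) - (U (x + Pi.single j 1, i) : 𝕄)‖ + ‖(1 : 𝕄) - (U (x, j) : 𝕄)‖) ^ 2 := by gcongr
    _ ≤ _ := by
        -- four-term Cauchy–Schwarz, the print's «Σ_j |x^j| ≤ 2[Σ_j |x^j|²]^{1/2}» (p0018)
        nlinarith [sq_nonneg (‖(1 : 𝕄) - (U (x, i) : 𝕄)‖ - ‖(1 : 𝕄) - (U (x + Pi.single i 1, j) : 𝕄)‖),
          sq_nonneg (‖(1 : 𝕄) - (U (x, i) : 𝕄)‖ - ‖(1 : 𝕄) - (U (x + Pi.single j 1, i) : 𝕄)‖),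
          sq_nonneg (‖(1 : 𝕄) - (U (x, i) : 𝕄)‖ - ‖(1 : 𝕄) - (U (x, j) : 𝕄)‖),
          sq_nonneg (‖(1 : 𝕄) - (U (x + Pi.single i 1, j) : 𝕄)‖ - ‖(1 : 𝕄) - (U (x + Pi.single j 1, i) : 𝕄)‖),
          sq_nonneg (‖(1 : 𝕄) - (U (x + Pi.single i 1, j) : 𝕄)‖ - ‖(1 : 𝕄) - (U (x, j) : 𝕄)‖),
          sq_nonneg (‖(1 : 𝕄) - (U (x + Pi.single j 1, i) : 𝕄)‖ - ‖(1 : 𝕄) - (U (x, j) : 𝕄)‖)]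

/-! ## §2. The single-bond, single-plaquette partition functions `z_u`, `z_ℓ` -/

variable (N) in
/-- The single-plaquette weight `w_β(U) = exp[−β(N − Re tr U)] = exp[−(a^{d−4}/g²)‖U − 1‖²_{H-S}]`, `β = 2a^{d−4}/g²`, as an
extended non-negative real. [cite: FariaDaVeigaOCarroll2022YMStability, (Ap)/(part) (chunk p0006)] -/
def pw (β : ℝ) (U : 𝔾 N) : ℝ≥0∞ := ENNReal.ofReal (Real.exp (-β * ((N : ℝ) - ((U : 𝕄).trace).re)))

variable (N) in
/-- **(zu)** «`z_u = ∫ exp[−2(a^{d−4}/g²) Re Tr(1−U)] dσ(U)`», i.e. `∫ exp[−β(N − Re tr U)] dσ(U)` with `β = 2a^{d−4}/g²`, the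
single-bond single-plaquette partition function of the upper bound. [cite: FariaDaVeigaOCarroll2022YMStability, Theorem 1 (zu) (chunk p0014)] -/
def zu (β : ℝ) : ℝ≥0∞ := ∫⁻ U, pw N β U ∂haarProbability (𝔾 N)

variable (d N) in
/-- **(zl)** in the Frobenius currency: `z_ℓ = ∫ exp[−4(d−1)β ‖1 − U‖²] dσ(U)` (`= ∫ exp[−8(d−1)(a^{d−4}/g²)‖U−1‖²_{H-S}] dσ`; the
printed `∫ exp[−2C²(a^{d−4}/g²)(d−1) Tr X²] dσ`, `C² = 4N`, is `≤` this one since `‖U − 1‖²_{H-S} ≤ Tr X² ≤ N Tr X²`).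
[cite: FariaDaVeigaOCarroll2022YMStability, Theorem 1 (zl) (chunk p0014)] -/
def zl (β : ℝ) : ℝ≥0∞ :=
  ∫⁻ U, ENNReal.ofReal (Real.exp (-(4 * ((d - 1 : ℕ) : ℝ) * β) * ‖(1 : 𝕄) - (U : 𝕄)‖ ^ 2)) ∂haarProbability (𝔾 N)

/-- The exponent of `w_β`: `N − Re tr U = ‖1 − U‖²/2`. [cite: FariaDaVeigaOCarroll2022YMStability, (Ap) (chunk p0006)] -/
theorem pw_eq (β : ℝ) (U : 𝔾 N) : pw N β U = ENNReal.ofReal (Real.exp (-β * (‖(1 : 𝕄) - (U : 𝕄)‖ ^ 2 / 2))) := by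
  rw [pw, sub_re_trace_eq]

/-- `z_u = ∫ exp[−β ‖1 − U‖²/2] dσ(U)`. [cite: FariaDaVeigaOCarroll2022YMStability, (zu)/(Ap)] -/
theorem zu_eq_lintegral_norm (β : ℝ) :
    zu N β = ∫⁻ U, ENNReal.ofReal (Real.exp (-β * (‖(1 : 𝕄) - (U : 𝕄)‖ ^ 2 / 2))) ∂haarProbability (𝔾 N) :=
  lintegral_congr fun U => pw_eq β U

/-- The trace of the underlying matrix is continuous on `U(N)`. [folklore] -/
private theorem continuous_re_trace : Continuous fun U : 𝔾 N => ((U : 𝕄).trace).re :=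
  Complex.continuous_re.comp (continuous_subtype_val.matrix_trace)

/-- `w_β` is measurable. [folklore] -/
private theorem measurable_pw (β : ℝ) : Measurable (pw N β) :=
  ENNReal.measurable_ofReal.comp (Real.measurable_exp.comp
    ((measurable_const.sub continuous_re_trace.measurable).const_mul (-β)))

/-- `w_β ≤ 1` for `β ≥ 0` (the action is non-negative). [cite: FariaDaVeigaOCarroll2022YMStability, §2 («A_p is pointwise positive», chunk p0006)] -/
theorem pw_le_one {β : ℝ} (hβ : 0 ≤ β) (U : 𝔾 N) : pw N β U ≤ 1 := by
  rw [pw_eq]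
  refine ENNReal.ofReal_le_one.2 (Real.exp_le_one_iff.2 ?_)
  have : 0 ≤ β * (‖(1 : 𝕄) - (U : 𝕄)‖ ^ 2 / 2) := by positivity
  linarith

/-- `w_β < ∞`. [folklore] -/
private theorem pw_ne_top (β : ℝ) (U : 𝔾 N) : pw N β U ≠ ∞ := ENNReal.ofReal_ne_top

/-- `z_u ≤ 1` for `β ≥ 0`. [cite: FariaDaVeigaOCarroll2022YMStability, Theorem 1] -/
theorem zu_le_one {β : ℝ} (hβ : 0 ≤ β) : zu N β ≤ 1 := by
  calc zu N β ≤ ∫⁻ _U, 1 ∂haarProbability (𝔾 N) := lintegral_mono fun U => pw_le_one hβ U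
    _ = 1 := by rw [lintegral_const, measure_univ, mul_one]

/-- `z_ℓ ≤ 1` for `β ≥ 0`. [cite: FariaDaVeigaOCarroll2022YMStability, Theorem 1] -/
theorem zl_le_one {β : ℝ} (hβ : 0 ≤ β) : zl d N β ≤ 1 := by
  calc zl d N β ≤ ∫⁻ _U, 1 ∂haarProbability (𝔾 N) := lintegral_mono fun U => by
          refine ENNReal.ofReal_le_one.2 (Real.exp_le_one_iff.2 ?_)
          have : 0 ≤ 4 * ((d - 1 : ℕ) : ℝ) * β * ‖(1 : 𝕄) - (U : 𝕄)‖ ^ 2 := by positivity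
          linarith
    _ = 1 := by rw [lintegral_const, measure_univ, mul_one]

/-! ## §3. Geometry of the successive bond integrations: partner plaquettes of free edges -/

/-- The four (positively oriented) edges of the plaquette `p = (x, i, j)`, in the order of the holonomy
`U_p = U(x,i) U(x+eᵢ,j) U(x+eⱼ,i)⁻¹ U(x,j)⁻¹`. [folklore] -/
def edges (p : Plaq d) : Finset (ZdEdge d) :=
  {(p.1, p.2.1), (p.1 + Pi.single p.2.1 1, p.2.2), (p.1 + Pi.single p.2.2 1, p.2.1), (p.1, p.2.2)}

/-- A plaquette holonomy only reads its four edges. [folklore] -/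
private theorem plaquette_congr_of_edges {G : Type*} [Group G] {U V : ZdGaugeConfig d G} {p : Plaq d}
    (h : ∀ e ∈ edges p, U e = V e) : U.plaquette p.1 p.2.1 p.2.2 = V.plaquette p.1 p.2.1 p.2.2 :=
  plaquette_congr (h _ (by simp [edges])) (h _ (by simp [edges])) (h _ (by simp [edges])) (h _ (by simp [edges]))

/-- The directions `m` above the direction of the edge `e = (y, k)` in which its base point is non-zero. [folklore] -/
def upDirs (e : ZdEdge d) : Finset (Fin d) := univ.filter fun m => e.2 < m ∧ e.1 m ≠ 0

/-- An edge is free (not on the comb tree) iff some direction above its own carries a non-zero coordinate.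
[cite: arXiv160201222, §2] -/
theorem upDirs_nonempty_iff {e : ZdEdge d} : (upDirs e).Nonempty ↔ ¬ IsComb e := by
  simp only [upDirs, IsComb, Finset.Nonempty, Finset.mem_filter, Finset.mem_univ, true_and, not_forall,
    exists_prop]

/-- `topDir e`: the LARGEST direction `m > k` with `y_m ≠ 0`, for a free edge `e = (y, k)` (junk value `k` on the comb). [folklore] -/
def topDir (e : ZdEdge d) : Fin d := if h : (upDirs e).Nonempty then (upDirs e).max' h else e.2

/-- `topDir e` is one of the admissible directions of a free edge. [folklore] -/
private theorem topDir_mem_upDirs {e : ZdEdge d} (he : ¬ IsComb e) : topDir e ∈ upDirs e := by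
  rw [topDir, dif_pos (upDirs_nonempty_iff.2 he)]; exact Finset.max'_mem _ _

/-- `k < topDir (y,k)`. [folklore] -/
private theorem lt_topDir {e : ZdEdge d} (he : ¬ IsComb e) : e.2 < topDir e :=
  ((Finset.mem_filter.1 (topDir_mem_upDirs he)).2).1

/-- `y_{topDir} ≠ 0`. [folklore] -/
private theorem apply_topDir_ne_zero {e : ZdEdge d} (he : ¬ IsComb e) : e.1 (topDir e) ≠ 0 :=
  ((Finset.mem_filter.1 (topDir_mem_upDirs he)).2).2

/-- Maximality: above `topDir` all coordinates vanish. [folklore] -/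
private theorem apply_eq_zero_of_topDir_lt {e : ZdEdge d} (he : ¬ IsComb e) {m : Fin d} (hm : topDir e < m) : e.1 m = 0 := by
  by_contra hne
  have hmem : m ∈ upDirs e := Finset.mem_filter.2 ⟨Finset.mem_univ _, (lt_topDir he).trans hm, hne⟩
  have hle : m ≤ topDir e := by
    rw [topDir, dif_pos (upDirs_nonempty_iff.2 he)]; exact Finset.le_max' _ _ hmem
  exact absurd hm (not_lt.2 hle)

/-- The **partner plaquette** of a free edge `e = (y, k)`: `(y − e_m, k, m)`, `m = topDir e` — the plaquette in the `(k, m)`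
plane just below `e` in direction `m`, in which `e` is the third (inverted) letter of the holonomy.  This is the print's
pairing «for each horizontal bond variable, integration appears in only one plaquette» (§6.2, p0018), for every `d`.
[cite: FariaDaVeigaOCarroll2022YMStability, §6.2 (chunk p0018)] -/
def partner (e : ZdEdge d) : Plaq d := (e.1 - Pi.single (topDir e) 1, e.2, topDir e)

/-- The third edge of the partner plaquette is the edge itself. [folklore] -/
private theorem partner_fst_add (e : ZdEdge d) : (partner e).1 + Pi.single (partner e).2.2 1 = e.1 := by
  simp [partner]

/-- Reading an edge off its partner plaquette. [folklore] -/
def ofPartner (p : Plaq d) : ZdEdge d := (p.1 + Pi.single p.2.2 1, p.2.1)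

/-- `ofPartner` is a left inverse of `partner`. [folklore] -/
private theorem ofPartner_partner (e : ZdEdge d) : ofPartner (partner e) = e := by
  obtain ⟨y, k⟩ := e; simp [ofPartner, partner]

/-- Distinct free edges have distinct partner plaquettes (so the retained plaquettes of §6.2 are in bijection with the
retained bonds, «we integrate over the `Λ_r` horizontal bonds, so that we extract a factor `z_u^{Λ_r}`»).
[cite: FariaDaVeigaOCarroll2022YMStability, §6.2 (chunk p0018)] -/
theorem partner_injective : Injective (partner (d := d)) :=
  (LeftInverse.injective ofPartner_partner : Injective (partner (d := d)))

/-- The partner plaquette of a free edge of the cube `B_n` is a plaquette of `B_n`. [cite: FariaDaVeigaOCarroll2022YMStability, §6.2] -/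
theorem partner_mem_plaquettesIn {n : ℕ} {e : ZdEdge d} (he : e ∈ freeEdges d n) :
    partner e ∈ plaquettesIn (halfOpenBox d n) := by
  obtain ⟨y, k⟩ := e
  rw [freeEdges, Finset.mem_filter] at he
  obtain ⟨hbox, hfree⟩ := he
  obtain ⟨hcoord, hk⟩ := mem_boxEdges_iff.1 hbox
  have hkm : k < topDir (y, k) := lt_topDir hfree
  have hym : y (topDir (y, k)) ≠ 0 := apply_topDir_ne_zero hfree
  rw [Plaq.mem_plaquettesIn]
  simp only [partner]
  generalize topDir (y, k) = m at hkm hym ⊢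
  have hym1 : 1 ≤ y m := by have := (hcoord m).1; omega
  have hkm' : k ≠ m := ne_of_lt hkm
  refine ⟨mem_halfOpenBox.2 fun l => ?_, hkm, mem_halfOpenBox.2 fun l => ?_, mem_halfOpenBox.2 fun l => ?_,
    mem_halfOpenBox.2 fun l => ?_⟩ <;>
  · obtain ⟨h0, h1⟩ := hcoord l
    simp only [Pi.add_apply, Pi.sub_apply, Pi.single_apply]
    split_ifs <;> subst_vars <;> omega

/-- **The elimination order.**  If a free edge `e₀ ≠ e` lies on the partner plaquette of the free edge `e`, then `e` is
`e₀` translated by one unit in direction `topDir e` (same direction of the edge): the only conflicts are "one step up", so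
the free edge of maximal height in any family meets no other partner plaquette of the family — the print's «integrate over
successive planes … starting at `x⁰ = L` and ending at `x⁰ = 2`» for every `d`. [cite: FariaDaVeigaOCarroll2022YMStability, §6.2 (chunk p0018)] -/
theorem eq_of_mem_edges_partner {e e₀ : ZdEdge d} (he : ¬ IsComb e) (he₀ : ¬ IsComb e₀)
    (hmem : e₀ ∈ edges (partner e)) (hne : e₀ ≠ e) :
    e₀.2 = e.2 ∧ e.1 = e₀.1 + Pi.single (topDir e) 1 := by
  obtain ⟨y, k⟩ := e
  obtain ⟨y₀, k₀⟩ := e₀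
  set m := topDir (y, k) with hm
  have hkm : k < m := lt_topDir he
  have hzero : ∀ m' : Fin d, m < m' → y m' = 0 := fun m' h => apply_eq_zero_of_topDir_lt he h
  have hfree₀ : ∃ m' : Fin d, k₀ < m' ∧ y₀ m' ≠ 0 := by
    simpa [IsComb] using he₀
  simp only [edges, partner, Finset.mem_insert, Finset.mem_singleton, Prod.mk.injEq, sub_add_cancel] at hmem
  rcases hmem with ⟨h1, h2⟩ | ⟨h1, h2⟩ | ⟨h1, h2⟩ | ⟨h1, h2⟩
  · exact ⟨h2, by rw [h1, sub_add_cancel]⟩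
  · exfalso
    obtain ⟨m', hm'lt, hm'ne⟩ := hfree₀
    rw [h2] at hm'lt
    have hmk : m' ≠ k := ne_of_gt (hkm.trans hm'lt)
    have : y₀ m' = y m' := by
      rw [h1]; simp [Pi.single_eq_of_ne (ne_of_gt hm'lt), Pi.single_eq_of_ne hmk]
    exact hm'ne (this ▸ hzero m' hm'lt)
  · exact absurd (Prod.ext h1 h2) hne
  · exfalso
    obtain ⟨m', hm'lt, hm'ne⟩ := hfree₀
    rw [h2] at hm'lt
    have : y₀ m' = y m' := by
      rw [h1]; simp [Pi.single_eq_of_ne (ne_of_gt hm'lt)]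
    exact hm'ne (this ▸ hzero m' hm'lt)

/-- Consequence for box edges (non-negative coordinates): a conflicting free edge is exactly one unit LOWER in `ℓ¹` height.
[cite: FariaDaVeigaOCarroll2022YMStability, §6.2] -/
theorem l1_eq_of_mem_edges_partner {n : ℕ} {e e₀ : ZdEdge d} (he : e ∈ freeEdges d n) (he₀ : e₀ ∈ freeEdges d n)
    (hmem : e₀ ∈ edges (partner e)) (hne : e₀ ≠ e) : l1 e.1 = l1 e₀.1 + 1 := by
  rw [freeEdges, Finset.mem_filter] at he he₀
  obtain ⟨-, h⟩ := eq_of_mem_edges_partner he.2 he₀.2 hmem hne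
  rw [h]
  obtain ⟨y₀, k₀⟩ := e₀
  exact l1_add_single ((mem_boxEdges_iff.1 he₀.1).1 _).1


/-! ## §4. The upper bound: successive single-bond Haar integrations (§6.2) -/

section Cube

variable {n : ℕ}

/-- Updating one box coordinate does not change the extended configuration off that edge. [folklore] -/
private theorem ext_update_of_ne (u : BoxCfg d (𝔾 N) n) (e₀ : ↥(boxEdges d n)) (g : 𝔾 N) {e : ZdEdge d}
    (h : e ≠ e₀.1) : ext (update u e₀ g) e = ext u e := by
  by_cases he : e ∈ boxEdges d n
  · rw [ext_apply_of_mem _ he, ext_apply_of_mem _ he, update_of_ne]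
    exact fun h' => h (congrArg Subtype.val h')
  · rw [ext_apply_of_not_mem _ he, ext_apply_of_not_mem _ he]

/-- … and on that edge it reads the new value. [folklore] -/
private theorem ext_update_self (u : BoxCfg d (𝔾 N) n) (e₀ : ↥(boxEdges d n)) (g : 𝔾 N) {e : ZdEdge d}
    (h : e = e₀.1) : ext (update u e₀ g) e = g := by
  subst h; rw [ext_apply_of_mem _ e₀.2]; simp

/-- The weight of the partner plaquette of the edge `e`, as a function of the configuration on the cube. [cite: FariaDaVeigaOCarroll2022YMStability, §6.2] -/
def pwPartner (β : ℝ) (e : ZdEdge d) (u : BoxCfg d (𝔾 N) n) : ℝ≥0∞ :=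
  pw N β ((ext u).plaquette (partner e).1 (partner e).2.1 (partner e).2.2)

/-- Plaquette holonomies of the extended box configuration are measurable in the box variables. [folklore] -/
private theorem measurable_plaquette_ext (p : Plaq d) :
    Measurable fun u : BoxCfg d (𝔾 N) n => (ext u).plaquette p.1 p.2.1 p.2.2 := by
  have h : ∀ e : ZdEdge d, Measurable fun u : BoxCfg d (𝔾 N) n => ext u e := fun e =>
    (measurable_pi_apply e).comp measurable_ext
  unfold ZdGaugeConfig.plaquette
  exact (((h _).mul (h _)).mul (h _).inv).mul (h _).inv

/-- Partner weights are measurable in the box variables. [folklore] -/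
private theorem measurable_pwPartner (β : ℝ) (e : ZdEdge d) : Measurable (pwPartner (N := N) (n := n) β e) :=
  (measurable_pw β).comp (measurable_plaquette_ext _)

/-- A partner weight does not see the update of a variable off its four edges. [folklore] -/
private theorem pwPartner_update_of_not_mem {β : ℝ} {e : ZdEdge d} {e₀ : ↥(boxEdges d n)}
    (h : e₀.1 ∉ edges (partner e)) (u : BoxCfg d (𝔾 N) n) (g : 𝔾 N) :
    pwPartner β e (update u e₀ g) = pwPartner (N := N) β e u := by
  unfold pwPartner
  rw [plaquette_congr_of_edges (U := ext (update u e₀ g)) (V := ext u)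
    (fun e' he' => ext_update_of_ne u e₀ g (fun hh => h (hh ▸ he')))]

/-- **The Haar extraction** (§6.2: «integration appears in only one plaquette … using the left or right invariance of the
Haar measure, the integral is independent of the other variables. In this way, we extract a factor `z_u`»): integrating the
variable of a free edge in the weight of ITS OWN partner plaquette, all other variables frozen, gives exactly `z_u` — the
letter is `U(e)⁻¹` between two frozen words, and the Haar probability measure of `U(N)` is left-, right- and
inversion-invariant. [cite: FariaDaVeigaOCarroll2022YMStability, §6.2 (chunk p0018)] -/
theorem lintegral_pwPartner_update {β : ℝ} {e₀ : ↥(boxEdges d n)} (he₀ : ¬ IsComb e₀.1)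
    (u : BoxCfg d (𝔾 N) n) :
    ∫⁻ g, pwPartner β e₀.1 (update u e₀ g) ∂haarProbability (𝔾 N) = zu N β := by
  obtain ⟨⟨y, k⟩, hy⟩ := e₀
  have hm : k < topDir (y, k) := lt_topDir he₀
  have hne2 : topDir (y, k) ≠ k := ne_of_gt hm
  have hE1 : (y - Pi.single (topDir (y, k)) 1, k) ≠ (y, k) := by
    intro h
    have h2 : (Pi.single (topDir (y, k)) (1 : ℤ) : ZSite d) = 0 := sub_eq_self.1 (Prod.mk.inj h).1
    have h3 := congrFun h2 (topDir (y, k))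
    simp at h3
  have hE2 : (y - Pi.single (topDir (y, k)) 1 + Pi.single k 1, topDir (y, k)) ≠ (y, k) :=
    fun h => hne2 (Prod.mk.inj h).2
  have hE3 : (y - Pi.single (topDir (y, k)) 1 + Pi.single (topDir (y, k)) 1, k) = (y, k) := by
    rw [sub_add_cancel]
  have hE4 : (y - Pi.single (topDir (y, k)) 1, topDir (y, k)) ≠ (y, k) := fun h => hne2 (Prod.mk.inj h).2
  -- the three frozen letters
  set a : 𝔾 N := ext u (y - Pi.single (topDir (y, k)) 1, k) *
    ext u (y - Pi.single (topDir (y, k)) 1 + Pi.single k 1, topDir (y, k)) with ha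
  set c : 𝔾 N := ext u (y - Pi.single (topDir (y, k)) 1, topDir (y, k)) with hc
  have hhol : ∀ g : 𝔾 N, pwPartner β (y, k) (update u ⟨(y, k), hy⟩ g) = pw N β (a * g⁻¹ * c⁻¹) := by
    intro g
    simp only [pwPartner, partner, ZdGaugeConfig.plaquette]
    rw [ext_update_of_ne u ⟨(y, k), hy⟩ g hE1, ext_update_of_ne u ⟨(y, k), hy⟩ g hE2, hE3,
      ext_update_self u ⟨(y, k), hy⟩ g rfl, ext_update_of_ne u ⟨(y, k), hy⟩ g hE4]
  show ∫⁻ g, pwPartner β (y, k) (update u ⟨(y, k), hy⟩ g) ∂haarProbability (𝔾 N) = zu N β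
  simp_rw [hhol]
  have h1 := lintegral_inv_eq_self (μ := haarProbability (𝔾 N)) (fun g : 𝔾 N => pw N β (a * g * c⁻¹))
  rw [h1]
  have h2 := lintegral_mul_left_eq_self (μ := haarProbability (𝔾 N)) (fun g : 𝔾 N => pw N β (g * c⁻¹)) a
  rw [h2]
  have h3 := lintegral_mul_right_eq_self (μ := haarProbability (𝔾 N)) (fun g : 𝔾 N => pw N β g) c⁻¹
  rw [h3]
  rfl

/-- The product of the partner weights over a family `T` of (free) box edges. [cite: FariaDaVeigaOCarroll2022YMStability, §6.2] -/
def prodPw (β : ℝ) (T : Finset ↥(boxEdges d n)) (u : BoxCfg d (𝔾 N) n) : ℝ≥0∞ :=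
  ∏ e ∈ T, pwPartner β e.1 u

/-- Products of partner weights are measurable. [folklore] -/
private theorem measurable_prodPw (β : ℝ) (T : Finset ↥(boxEdges d n)) : Measurable (prodPw (N := N) β T) :=
  Finset.measurable_prod _ fun e _ => measurable_pwPartner β e.1

/-- **The exact product formula**: for every family `T` of free edges of the cube,
`∫ ∏_{e ∈ T} w_β(U_{partner e}) dσ^{E_n}(U) = z_u^{#T}` — induction on the free edge of maximal `ℓ¹` height, which
meets no other partner plaquette of the family (`eq_of_mem_edges_partner`), Tonelli one variable at a time (Mathlib
`lmarginal`) and the Haar extraction.  The print's «In the total procedure, we integrate over the `Λ_r` horizontal bonds,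
so that we extract a factor `z_u^{Λ_r}`». [cite: FariaDaVeigaOCarroll2022YMStability, Theorem 1 proof, §6.2 (chunk p0018)] -/
theorem lintegral_prodPw_eq (β : ℝ) (T : Finset ↥(boxEdges d n)) (hT : ∀ e ∈ T, ¬ IsComb e.1) :
    ∫⁻ u, prodPw β T u ∂Measure.pi (fun _ : ↥(boxEdges d n) => haarProbability (𝔾 N)) = zu N β ^ #T := by
  classical
  revert hT
  refine Finset.induction_on_max_value (f := fun e : ↥(boxEdges d n) => l1 e.1.1)
    (motive := fun T => (∀ e ∈ T, ¬ IsComb e.1) →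
      ∫⁻ u, prodPw β T u ∂Measure.pi (fun _ : ↥(boxEdges d n) => haarProbability (𝔾 N)) = zu N β ^ #T)
    T ?_ ?_
  · intro _
    simp [prodPw]
  · intro a s has hmax ih hfree
    have ha : ¬ IsComb a.1 := hfree a (Finset.mem_insert_self _ _)
    have hs : ∀ e ∈ s, ¬ IsComb e.1 := fun e he => hfree e (Finset.mem_insert_of_mem he)
    have haF : a.1 ∈ freeEdges d n := Finset.mem_filter.2 ⟨a.2, ha⟩
    -- the maximal edge `a` is private to its own partner plaquette
    have hpriv : ∀ e ∈ s, a.1 ∉ edges (partner e.1) := by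
      intro e he hmem
      have heF : e.1 ∈ freeEdges d n := Finset.mem_filter.2 ⟨e.2, hs e he⟩
      have hne : a.1 ≠ e.1 := fun h => has (Subtype.ext h ▸ he)
      have h1 := l1_eq_of_mem_edges_partner heF haF hmem hne
      have h2 : l1 e.1.1 ≤ l1 a.1.1 := hmax e he
      omega
    have hupd : ∀ (u : BoxCfg d (𝔾 N) n) (g : 𝔾 N), prodPw β s (update u a g) = prodPw (N := N) β s u :=
      fun u g => Finset.prod_congr rfl fun e he => pwPartner_update_of_not_mem (hpriv e he) u g
    set μs : ↥(boxEdges d n) → Measure (𝔾 N) := fun _ => haarProbability (𝔾 N) with hμs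
    set Φ : BoxCfg d (𝔾 N) n → ℝ≥0∞ := fun u => pwPartner β a.1 u * prodPw β s u with hΦ
    set Ψ : BoxCfg d (𝔾 N) n → ℝ≥0∞ := fun u => zu N β * prodPw β s u with hΨ
    have hΦm : Measurable Φ := (measurable_pwPartner β a.1).mul (measurable_prodPw β s)
    have hΨm : Measurable Ψ := (measurable_prodPw β s).const_mul _
    have hins : prodPw (N := N) β (insert a s) = Φ := by
      funext u; simp only [prodPw, hΦ, Finset.prod_insert has]
    have hmarg : (∫⋯∫⁻_{a}, Φ ∂μs) = (∫⋯∫⁻_{a}, Ψ ∂μs) := by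
      rw [lmarginal_singleton, lmarginal_singleton]
      funext u
      simp only [hΦ, hΨ, hμs, hupd]
      have hmeas : Measurable fun g : 𝔾 N => pwPartner β a.1 (update u a g) :=
        (measurable_pwPartner β a.1).comp (measurable_update u)
      rw [lintegral_mul_const _ hmeas,
        lintegral_pwPartner_update ha u, lintegral_const, measure_univ, mul_one]
    have hint : ∫⁻ u, Φ u ∂Measure.pi μs = ∫⁻ u, Ψ u ∂Measure.pi μs := by
      rw [lintegral_eq_lmarginal_univ (1 : BoxCfg d (𝔾 N) n), lintegral_eq_lmarginal_univ (1 : BoxCfg d (𝔾 N) n),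
        ← Finset.sdiff_union_of_subset (Finset.subset_univ {a}),
        lmarginal_union _ _ hΦm Finset.sdiff_disjoint, lmarginal_union _ _ hΨm Finset.sdiff_disjoint, hmarg]
    rw [hins, hint, hΨ, lintegral_const_mul _ (measurable_prodPw β s), ih hs, Finset.card_insert_of_notMem has,
      pow_succ']

/-- The Boltzmann weight of the cube is the product of the single-plaquette weights:
`exp[−β S_{B_n}(U)] = ∏_{p ∈ B_n'} w_β(U_p)`. [cite: FariaDaVeigaOCarroll2022YMStability, (part)/(action) (chunk p0006)] -/
theorem weight_eq_prod (β : ℝ) (U : ZdGaugeConfig d (𝔾 N)) :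
    ENNReal.ofReal (Real.exp (-β * S d N n U)) =
      ∏ p ∈ plaquettesIn (halfOpenBox d n), pw N β (U.plaquette p.1 p.2.1 p.2.2) := by
  unfold pw
  rw [← ENNReal.ofReal_prod_of_nonneg (fun _ _ => (Real.exp_pos _).le), ← Real.exp_sum]
  congr 1
  simp only [WilsonWeakCoupling.S, zdWilsonAction, unitaryFundamentalRep_apply, Finset.mul_sum]

/-- **Theorem 1, upper bound (free b.c.)**: `Z(B_n, β) ≤ z_u^{Λ_r}`, `Λ_r = #E_n^1` the number of retained (non-comb) bonds —
«An upper bound is obtained by discarding all [non-partner] plaquettes from the action … we integrate over the `Λ_r`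
horizontal bonds, so that we extract a factor `z_u^{Λ_r}`» — for `U(N)`, every `d`, every cube side `n` and every
`β ≥ 0`. [cite: FariaDaVeigaOCarroll2022YMStability, Theorem 1 (sbfree), right inequality (chunk p0014); proof §6.2 (p0018)] -/
theorem Z_le_zu_pow {β : ℝ} (hβ : 0 ≤ β) (n : ℕ) : Z d N n β ≤ zu N β ^ #(freeEdges d n) := by
  classical
  set T : Finset ↥(boxEdges d n) := univ.filter fun e => ¬ IsComb e.1 with hT
  have hTfree : ∀ e ∈ T, ¬ IsComb e.1 := fun e he => (Finset.mem_filter.1 he).2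
  have hcard : #T = #(freeEdges d n) := by
    rw [hT, ← Fintype.card_subtype, card_freeIdx]
  rw [Z_eq, ← hcard, ← lintegral_prodPw_eq β T hTfree]
  refine lintegral_mono fun u => ?_
  set P := plaquettesIn (halfOpenBox d n) with hP
  set P' := T.image fun e => partner e.1 with hP'
  have hsub : P' ⊆ P := Finset.image_subset_iff.2 fun e he =>
    partner_mem_plaquettesIn (Finset.mem_filter.2 ⟨e.2, hTfree e he⟩)
  have hinj : ∀ e ∈ T, ∀ e' ∈ T, partner e.1 = partner e'.1 → e = e' :=
    fun e _ e' _ h => Subtype.ext (partner_injective h)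
  rw [weight_eq_prod]
  calc ∏ p ∈ P, pw N β ((ext u).plaquette p.1 p.2.1 p.2.2)
      = (∏ p ∈ P \ P', pw N β ((ext u).plaquette p.1 p.2.1 p.2.2)) *
          ∏ p ∈ P', pw N β ((ext u).plaquette p.1 p.2.1 p.2.2) := (Finset.prod_sdiff hsub).symm
    _ ≤ 1 * ∏ p ∈ P', pw N β ((ext u).plaquette p.1 p.2.1 p.2.2) := by
        gcongr
        exact Finset.prod_le_one' fun p _ => pw_le_one hβ _
    _ = prodPw β T u := by
        rw [one_mul, hP', Finset.prod_image hinj]; rfl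

/-! ## §5. The lower bound: comb gauge, Lemma 1, Tonelli (§6.2 «Using Lemma 1 gives the factorization and z_ℓ») -/

/-- Counting a slot of the plaquettes of the cube fibrewise over the edges. [folklore] -/
private theorem sum_slot_eq (E : Plaq d → ZdEdge d) (hE : ∀ p ∈ plaquettesIn (halfOpenBox d n), E p ∈ boxEdges d n)
    (f : ZdEdge d → ℝ) :
    ∑ p ∈ plaquettesIn (halfOpenBox d n), f (E p) =
      ∑ e ∈ boxEdges d n, (#((plaquettesIn (halfOpenBox d n)).filter fun p => E p = e) : ℝ) * f e := by
  rw [← Finset.sum_fiberwise_of_maps_to' hE]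
  refine Finset.sum_congr rfl fun e _ => ?_
  rw [Finset.sum_const, nsmul_eq_mul]

/-- Slot 1: the plaquettes `(x, i, j)` with first edge `(x, i) = (y, k)` are indexed by `j > k`. [folklore] -/
private theorem card_fiber1_le (e : ZdEdge d) :
    #((plaquettesIn (halfOpenBox d n)).filter fun p => (p.1, p.2.1) = e) ≤ #(Finset.Ioi e.2) := by
  refine Finset.card_le_card_of_injOn (fun p => p.2.2) (fun p hp => ?_) (fun p hp p' hp' h => ?_)
  · obtain ⟨hp, he⟩ := Finset.mem_filter.1 hp
    rw [Finset.mem_coe, Finset.mem_Ioi, ← he]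
    exact (Plaq.mem_plaquettesIn.1 hp).2.1
  · obtain ⟨-, he⟩ := Finset.mem_filter.1 hp
    obtain ⟨-, he'⟩ := Finset.mem_filter.1 hp'
    obtain ⟨h1, h2⟩ := Prod.mk.inj (he.trans he'.symm)
    have h3 : p.2.2 = p'.2.2 := h
    exact Prod.ext h1 (Prod.ext h2 h3)

/-- Slot 2: the plaquettes with second edge `(x + eᵢ, j) = (y, k)` are indexed by `i < k`. [folklore] -/
private theorem card_fiber2_le (e : ZdEdge d) :
    #((plaquettesIn (halfOpenBox d n)).filter fun p => (p.1 + Pi.single p.2.1 1, p.2.2) = e) ≤ #(Finset.Iio e.2) := by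
  refine Finset.card_le_card_of_injOn (fun p => p.2.1) (fun p hp => ?_) (fun p hp p' hp' h => ?_)
  · obtain ⟨hp, he⟩ := Finset.mem_filter.1 hp
    rw [Finset.mem_coe, Finset.mem_Iio, ← he]
    exact (Plaq.mem_plaquettesIn.1 hp).2.1
  · obtain ⟨-, he⟩ := Finset.mem_filter.1 hp
    obtain ⟨-, he'⟩ := Finset.mem_filter.1 hp'
    obtain ⟨h1, h2⟩ := Prod.mk.inj (he.trans he'.symm)
    have h3 : p.2.1 = p'.2.1 := h
    rw [h3] at h1
    exact Prod.ext (add_right_cancel h1) (Prod.ext h3 h2)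

/-- Slot 3: the plaquettes with third edge `(x + eⱼ, i) = (y, k)` are indexed by `j > k`. [folklore] -/
private theorem card_fiber3_le (e : ZdEdge d) :
    #((plaquettesIn (halfOpenBox d n)).filter fun p => (p.1 + Pi.single p.2.2 1, p.2.1) = e) ≤ #(Finset.Ioi e.2) := by
  refine Finset.card_le_card_of_injOn (fun p => p.2.2) (fun p hp => ?_) (fun p hp p' hp' h => ?_)
  · obtain ⟨hp, he⟩ := Finset.mem_filter.1 hp
    rw [Finset.mem_coe, Finset.mem_Ioi, ← he]
    exact (Plaq.mem_plaquettesIn.1 hp).2.1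
  · obtain ⟨-, he⟩ := Finset.mem_filter.1 hp
    obtain ⟨-, he'⟩ := Finset.mem_filter.1 hp'
    obtain ⟨h1, h2⟩ := Prod.mk.inj (he.trans he'.symm)
    have h3 : p.2.2 = p'.2.2 := h
    rw [h3] at h1
    exact Prod.ext (add_right_cancel h1) (Prod.ext h2 h3)

/-- Slot 4: the plaquettes with fourth edge `(x, j) = (y, k)` are indexed by `i < k`. [folklore] -/
private theorem card_fiber4_le (e : ZdEdge d) :
    #((plaquettesIn (halfOpenBox d n)).filter fun p => (p.1, p.2.2) = e) ≤ #(Finset.Iio e.2) := by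
  refine Finset.card_le_card_of_injOn (fun p => p.2.1) (fun p hp => ?_) (fun p hp p' hp' h => ?_)
  · obtain ⟨hp, he⟩ := Finset.mem_filter.1 hp
    rw [Finset.mem_coe, Finset.mem_Iio, ← he]
    exact (Plaq.mem_plaquettesIn.1 hp).2.1
  · obtain ⟨-, he⟩ := Finset.mem_filter.1 hp
    obtain ⟨-, he'⟩ := Finset.mem_filter.1 hp'
    obtain ⟨h1, h2⟩ := Prod.mk.inj (he.trans he'.symm)
    have h3 : p.2.1 = p'.2.1 := h
    exact Prod.ext h1 (Prod.ext h3 h2)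

/-- **The incidence count**: every bond of the cube lies in at most `2(d−1)` of its plaquettes (`d−1−k` as a first edge,
`k` as a second, `d−1−k` as a third, `k` as a fourth, `k` its direction), so for `f ≥ 0`
`Σ_{p} Σ_{e ∈ p} f(e) ≤ 2(d−1) Σ_{e} f(e)` — the print's «summing over the retained plaquettes» with the factor `2(d−1)` of
(lower2). [cite: FariaDaVeigaOCarroll2022YMStability, Lemma 1 (lower2) (chunk p0014)] -/
theorem sum_plaquette_slots_le (f : ZdEdge d → ℝ) (hf : ∀ e, 0 ≤ f e) :
    ∑ p ∈ plaquettesIn (halfOpenBox d n),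
        (f (p.1, p.2.1) + f (p.1 + Pi.single p.2.1 1, p.2.2) + f (p.1 + Pi.single p.2.2 1, p.2.1) + f (p.1, p.2.2))
      ≤ 2 * ((d - 1 : ℕ) : ℝ) * ∑ e ∈ boxEdges d n, f e := by
  have hm := fun p (hp : p ∈ plaquettesIn (halfOpenBox d n)) => edges_mem_boxEdges hp
  simp only [Finset.sum_add_distrib]
  rw [sum_slot_eq (fun p => (p.1, p.2.1)) (fun p hp => (hm p hp).1),
    sum_slot_eq (fun p => (p.1 + Pi.single p.2.1 1, p.2.2)) (fun p hp => (hm p hp).2.1),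
    sum_slot_eq (fun p => (p.1 + Pi.single p.2.2 1, p.2.1)) (fun p hp => (hm p hp).2.2.1),
    sum_slot_eq (fun p => (p.1, p.2.2)) (fun p hp => (hm p hp).2.2.2),
    ← Finset.sum_add_distrib, ← Finset.sum_add_distrib, ← Finset.sum_add_distrib, Finset.mul_sum]
  refine Finset.sum_le_sum fun e _ => ?_
  have h1 := card_fiber1_le (n := n) e
  have h2 := card_fiber2_le (n := n) e
  have h3 := card_fiber3_le (n := n) e
  have h4 := card_fiber4_le (n := n) e
  rw [Fin.card_Ioi] at h1 h3
  rw [Fin.card_Iio] at h2 h4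
  have hk : (e.2 : ℕ) < d := e.2.is_lt
  have hsum : (#((plaquettesIn (halfOpenBox d n)).filter fun p => (p.1, p.2.1) = e) : ℝ) +
      #((plaquettesIn (halfOpenBox d n)).filter fun p => (p.1 + Pi.single p.2.1 1, p.2.2) = e) +
      #((plaquettesIn (halfOpenBox d n)).filter fun p => (p.1 + Pi.single p.2.2 1, p.2.1) = e) +
      #((plaquettesIn (halfOpenBox d n)).filter fun p => (p.1, p.2.2) = e) ≤ 2 * ((d - 1 : ℕ) : ℝ) := by
    have : #((plaquettesIn (halfOpenBox d n)).filter fun p => (p.1, p.2.1) = e) +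
        #((plaquettesIn (halfOpenBox d n)).filter fun p => (p.1 + Pi.single p.2.1 1, p.2.2) = e) +
        #((plaquettesIn (halfOpenBox d n)).filter fun p => (p.1 + Pi.single p.2.2 1, p.2.1) = e) +
        #((plaquettesIn (halfOpenBox d n)).filter fun p => (p.1, p.2.2) = e) ≤ 2 * (d - 1) := by
      omega
    exact_mod_cast this
  have hfe := hf e
  nlinarith

/-- **(lower2) in the comb gauge**: with the comb-tree variables set to `1`,
`S_{B_n}(U) ≤ 4(d−1) Σ_{e ∈ E_n^1} ‖1 − U_e‖²` (Lemma 1 per plaquette, the incidence count, and `‖1 − 1‖ = 0` on the tree).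
[cite: FariaDaVeigaOCarroll2022YMStability, Lemma 1 (lower2) (chunk p0014)] -/
theorem S_le_sum_free (v : FreeCfg d (𝔾 N) n) :
    S d N n (ext (ext₁ v)) ≤
      4 * ((d - 1 : ℕ) : ℝ) * ∑ e : {e : ↥(boxEdges d n) // ¬ IsComb e.1}, ‖(1 : 𝕄) - (v e : 𝕄)‖ ^ 2 := by
  classical
  set U : ZdGaugeConfig d (𝔾 N) := ext (ext₁ v) with hU
  set f : ZdEdge d → ℝ := fun e => ‖(1 : 𝕄) - (U e : 𝕄)‖ ^ 2 with hf
  have hf0 : ∀ e, 0 ≤ f e := fun e => sq_nonneg _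
  have h1 : S d N n U ≤ 2 * ∑ p ∈ plaquettesIn (halfOpenBox d n),
      (f (p.1, p.2.1) + f (p.1 + Pi.single p.2.1 1, p.2.2) + f (p.1 + Pi.single p.2.2 1, p.2.1) + f (p.1, p.2.2)) := by
    rw [S_eq, Finset.mul_sum]
    exact Finset.sum_le_sum fun p _ => by
      have := norm_one_sub_plaquette_sq_le U p.1 p.2.1 p.2.2
      simp only [hf]
      linarith
  have h2 := sum_plaquette_slots_le (n := n) f hf0
  have h3 : ∑ e ∈ boxEdges d n, f e = ∑ e : {e : ↥(boxEdges d n) // ¬ IsComb e.1}, ‖(1 : 𝕄) - (v e : 𝕄)‖ ^ 2 := by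
    rw [← Finset.sum_coe_sort (boxEdges d n),
      ← Fintype.sum_subtype_add_sum_subtype (fun e : ↥(boxEdges d n) => IsComb e.1) (fun e => f e)]
    have hz : ∑ e : {e : ↥(boxEdges d n) // IsComb e.1}, f e = 0 :=
      Finset.sum_eq_zero fun e _ => by
        simp only [hf, hU, ext_coe, ext₁_apply_of_isComb _ e.2]
        simp
    rw [hz, zero_add]
    exact Finset.sum_congr rfl fun e _ => by
      simp only [hf, hU, ext_coe, ext₁_apply_of_not_isComb _ e.2]
  have h4 : (0 : ℝ) ≤ (d - 1 : ℕ) := Nat.cast_nonneg _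
  calc S d N n U ≤ 2 * (2 * ((d - 1 : ℕ) : ℝ) * ∑ e ∈ boxEdges d n, f e) := by nlinarith
    _ = _ := by rw [h3]; ring

/-- `U ↦ ‖1 − U‖²` is continuous on `U(N)`. [folklore] -/
private theorem continuous_norm_one_sub_sq : Continuous fun U : 𝔾 N => ‖(1 : 𝕄) - (U : 𝕄)‖ ^ 2 :=
  ((continuous_const.sub continuous_subtype_val).norm).pow 2

/-- The integrand of `z_ℓ` is measurable. [folklore] -/
private theorem measurable_zlWeight (c : ℝ) :
    Measurable fun U : 𝔾 N => ENNReal.ofReal (Real.exp (c * ‖(1 : 𝕄) - (U : 𝕄)‖ ^ 2)) :=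
  ENNReal.measurable_ofReal.comp (Real.measurable_exp.comp (continuous_norm_one_sub_sq.measurable.const_mul c))

/-- Pointwise, in the comb gauge: `∏_{e ∈ E_n^1} exp[−4(d−1)β‖1 − U_e‖²] ≤ exp[−β S_{B_n}(U)]` for `β ≥ 0`.
[cite: FariaDaVeigaOCarroll2022YMStability, §6.2 «Lower Bound: Using Lemma 1 gives the factorization and z_ℓ» (chunk p0018)] -/
theorem prod_le_weight {β : ℝ} (hβ : 0 ≤ β) (v : FreeCfg d (𝔾 N) n) :
    ∏ e : {e : ↥(boxEdges d n) // ¬ IsComb e.1},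
        ENNReal.ofReal (Real.exp (-(4 * ((d - 1 : ℕ) : ℝ) * β) * ‖(1 : 𝕄) - (v e : 𝕄)‖ ^ 2))
      ≤ ENNReal.ofReal (Real.exp (-β * S d N n (ext (ext₁ v)))) := by
  rw [← ENNReal.ofReal_prod_of_nonneg (fun _ _ => (Real.exp_pos _).le), ← Real.exp_sum]
  refine ENNReal.ofReal_le_ofReal (Real.exp_le_exp.2 ?_)
  rw [← Finset.mul_sum]
  have h := S_le_sum_free (N := N) v
  have h0 : 0 ≤ ∑ e : {e : ↥(boxEdges d n) // ¬ IsComb e.1}, ‖(1 : 𝕄) - (v e : 𝕄)‖ ^ 2 :=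
    Finset.sum_nonneg fun _ _ => sq_nonneg _
  nlinarith

/-- **Theorem 1, lower bound (free b.c.)**: `z_ℓ^{Λ_r} ≤ Z(B_n, β)` — gauge away the comb tree (the tree's Cor. 9.4
`AxialGauge.lintegral_pi_eq_lintegral_free`: the value of the partition function is unchanged, the print's p0007 «(see
[GJ])»), bound the weight below by the product over the retained bonds (Lemma 1), and integrate bond by bond (Tonelli).
For `U(N)`, every `d`, `n`, `β ≥ 0`. [cite: FariaDaVeigaOCarroll2022YMStability, Theorem 1 (sbfree), left inequality (chunk p0014); proof §6.2 (p0018)] -/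
theorem zl_pow_le_Z {β : ℝ} (hβ : 0 ≤ β) (n : ℕ) : zl d N β ^ #(freeEdges d n) ≤ Z d N n β := by
  classical
  have hΦ : Measurable fun u : BoxCfg d (𝔾 N) n => ENNReal.ofReal (Real.exp (-β * S d N n (ext u))) :=
    ENNReal.measurable_ofReal.comp (Real.measurable_exp.comp ((measurable_S_ext n).const_mul _))
  rw [Z_eq, lintegral_pi_eq_lintegral_free hΦ (fun u => by
    show ENNReal.ofReal (Real.exp (-β * S d N n (ext (gaugeFixBox u)))) = _
    rw [WilsonWeakCoupling.S, zdWilsonAction_ext_gaugeFixBox])]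
  calc zl d N β ^ #(freeEdges d n)
      = ∏ _e : {e : ↥(boxEdges d n) // ¬ IsComb e.1}, zl d N β := by
        rw [Finset.prod_const, Finset.card_univ, card_freeIdx]
    _ = ∫⁻ v, ∏ e : {e : ↥(boxEdges d n) // ¬ IsComb e.1},
          ENNReal.ofReal (Real.exp (-(4 * ((d - 1 : ℕ) : ℝ) * β) * ‖(1 : 𝕄) - (v e : 𝕄)‖ ^ 2))
          ∂Measure.pi fun _ : {e : ↥(boxEdges d n) // ¬ IsComb e.1} => haarProbability (𝔾 N) := by
        rw [GaussianToolkit.lintegral_fintype_prod_eq_prod _ (fun _ => measurable_zlWeight _)]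
        rfl
    _ ≤ _ := lintegral_mono fun v => prod_le_weight hβ v

/-! ## §6. Theorem 1 (free boundary conditions) and the printed retained-bond counts -/

/-- **THEOREM 1 (free b.c.)** of Faria da Veiga–O'Carroll, (sbfree): `z_ℓ^{Λ_r} ≤ Z_{Λ,a} ≤ z_u^{Λ_r}` for the Wilson
`U(N)` lattice gauge theory on the cube of side `n` in `ℤ^d` with free boundary conditions, `Λ_r = #E_n^1 =
(d−1)n^d − dn^{d−1} + 1` the number of bonds retained by the enhanced temporal (comb) gauge, `β = 2a^{d−4}/g² ≥ 0`
arbitrary: BOTH BOUNDS UNIFORM IN THE VOLUME AND IN THE COUPLING («not restricted to small g²»).  `z_u` is the printed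
(zu); `z_ℓ` is (zl) in the Frobenius currency (see the module docstring: it dominates the printed `z_ℓ`, so the printed
lower bound follows). [cite: FariaDaVeigaOCarroll2022YMStability, Theorem 1 (sbfree) (chunk p0014)] -/
theorem theorem1_free {β : ℝ} (hβ : 0 ≤ β) (n : ℕ) :
    zl d N β ^ #(freeEdges d n) ≤ Z d N n β ∧ Z d N n β ≤ zu N β ^ #(freeEdges d n) :=
  ⟨zl_pow_le_Z hβ n, Z_le_zu_pow hβ n⟩

end Cube

/-- The printed retained-bond count for `d = 4`: «`Λ_r = (3L³−L²−L−1)(L−1)`» (p0007). [cite: FariaDaVeigaOCarroll2022YMStability, §2 (chunk p0007)] -/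
theorem card_freeEdges_d4 {n : ℕ} (hn : 1 ≤ n) :
    (#(freeEdges 4 n) : ℝ) = (3 * (n : ℝ) ^ 3 - (n : ℝ) ^ 2 - n - 1) * (n - 1) := by
  rw [card_freeEdges (by norm_num) hn]; norm_num; ring

/-- The printed retained-bond count for `d = 3`: «`Λ_r = (2L+1)(L−1)²`» (p0007). [cite: FariaDaVeigaOCarroll2022YMStability, §2 (chunk p0007)] -/
theorem card_freeEdges_d3 {n : ℕ} (hn : 1 ≤ n) :
    (#(freeEdges 3 n) : ℝ) = (2 * (n : ℝ) + 1) * ((n : ℝ) - 1) ^ 2 := by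
  rw [card_freeEdges (by norm_num) hn]; norm_num; ring

/-- The printed retained-bond count for `d = 2`: «`Λ_r = (L−1)²`» (p0007). [cite: FariaDaVeigaOCarroll2022YMStability, §2 (chunk p0007)] -/
theorem card_freeEdges_d2 {n : ℕ} (hn : 1 ≤ n) :
    (#(freeEdges 2 n) : ℝ) = ((n : ℝ) - 1) ^ 2 := by
  rw [card_freeEdges (by norm_num) hn]; norm_num; ring

end FariaDaVeigaOCarroll2022

end Literature.MathematicalPhysics.QuantumFieldTheory
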